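import Mathlib.Algebra.Polynomial.Laurent
import Mathlib.Algebra.Polynomial.Expand
import Mathlib.Algebra.Polynomial.Lifts
import Mathlib.Algebra.Polynomial.Roots
import Mathlib.Tactic.FieldSimp
import Mathlib.Tactic.LinearCombination
import HarnessLib

/-!
# `q`-palindromic polynomials and the real counterpart `p(x) = xⁿ h(x + q/x)`
# (Goresky–Tai 2017, App. §16.2 and Proposition 36, first part — over any commutative ring)

Topic `Literature/Algebra/Polynomial`; THEOREMS ONLY (no definition, no instance, no named fact;
D-0026 net debt 0).  Lane `lit-hodgefound` (summit `HodgeConjecture`, Track 2 foundations library),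
seat `lit-hodgefound-p15`, generation 56, row g56-#1.

THE PRINT.  M. Goresky, Y.-S. Tai, *Real structures on ordinary Abelian varieties*, arXiv:1701.07742
[GoreskyTai2017RealStructuresOrdinary], Appendix §16 «Weil polynomials and a real counterpart» (held
`paper:arxiv-1701.07742`, p0036), verbatim:

> §16.1 … A real (resp. real ordinary) Weil `q`-polynomial of degree `n` is a monic polynomial `h(x)`
> such that the polynomial `p(x) = xⁿ h(x + q/x)` is a Weil `q`-polynomial (resp. an ordinary Weil
> `q`-polynomial) (see also [Howe–Lauter]).
> §16.2 **Real counterpart.** Let `q ∈ ℚ`. Let us say that a monic polynomial `p(x) = x^{2n} +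
> a_{2n−1}x^{2n−1} + ⋯ + a₀ ∈ ℂ[x]` is *`q`-palindromic* if it has even degree and if
> `a_{n−r} = q^r a_{n+r}` for `1 ≤ r ≤ n`, or equivalently if `q^{−n} x^{2n} p(q/x) = p(x)`. … Let
> `p(x) = ∏_{j=1}^{n} (x − α_j)(x − q/α_j) = Σ_{i=0}^{2n} a_i x^i` be a `q`-palindromic polynomial with no
> real roots. Define the associated real counterpart `h(x) = ∏_{j=1}^{n} (x − (α_j + q/α_j)) = Σ b_i x^i` or
> equivalently, `p(x) = xⁿ h(x + q/x)`. If `h(x) ∈ ℤ[x]` has integer coefficients then the same is true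
> of `p(x)`. The following proposition gives a converse to this statement.
> **Proposition 36.** Fix `n, q ∈ ℤ` with `n > 0` and `q > 0`. There exists a universal
> `(n+1) × (2n+1)` integer matrix `A` and a universal `(n+1) × (n+1)` integer matrix `B` with the
> following property. For every `q`-palindromic polynomial `p(x) = Σ_{t=0}^{2n} a_t x^t ∈ ℂ[x]` with no real
> roots, if `h(x) = Σ_{k=0}^{n} b_k x^k` is the associated real counterpart, then for all `t`, `0 ≤ t ≤ 2n`
> we have: `a_t = Σ_{k=0}^{n} A_{tk} b_k` and `b_k = Σ_{s=0}^{n} B_{ks} a_{n+s}`. In particular, `p(x)` has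
> integer coefficients iff `h(x)` has integer coefficients. …
> *Proof.* … `p(x) = xⁿ h(x + q/x) = Σ_j b_j Σ_t C(j,t) q^{j−t} x^{n−j+2t}` … `A_{rj} =
> C(j, (r+j−n)/2) · q^{(n−r+j)/2}` provided that `r + j − n` is even and that `n − j ≤ r ≤ n + j`, and
> `A_{rj} = 0` otherwise. In particular, `A_{n+s,s} = 1` for all `0 ≤ s ≤ n`, and the lower half of the
> matrix `A` is nonsingular with determinant equal to `1`. We may take `B` to be the inverse of the
> lower half of `A`.

WHAT IS HERE — the algebra of §16.2 and the FIRST PART of Proposition 36, over an ARBITRARY commutative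
ring `R` and any `q : R` (the source takes `q ∈ ℚ`, coefficients in `ℂ`), stated WITHOUT a new
definition: the transform `h ↦ p` is written as the finite sum

  `𝒯_{q,n}(h) := Σ_{j ≤ n} C(b_j) · X^{n−j} · (X² + C q)^j`   (`b_j = h.coeff j`, `deg h ≤ n`),

which IS the printed `xⁿ h(x + q/x)` — see `toLaurent_transform`, the identity
`toLaurent 𝒯_{q,n}(h) = Tⁿ · h(T + q·T⁻¹)` in Mathlib's Laurent polynomial ring `R[T;T⁻¹]`, and
`eval_transform` (`p(x) = xⁿ h(x + q x⁻¹)` at every unit `x`).  «`q`-palindromic» for a polynomial of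
degree `≤ 2n` is the printed coefficient condition `∀ r ≤ n, a_{n−r} = q^r a_{n+r}`.

* §1 the Laurent bridge `toLaurent_transform`; additivity and the values on monomials
  (`transform_add`, `transform_sub`, `transform_C_mul_X_pow`, `transform_C`, `transform_map`).
* §2 the universal matrix `A`: `coeff_X_sq_add_C_pow` (`(X²+q)^j` has coefficient
  `C(j, k/2) q^{j−k/2}` at even `k`, `0` at odd `k`), **`coeff_transform`** (`a_r = Σ_j A_{rj} b_j` with
  `A_{rj} = C(j,(r+j−n)/2) q^{(n+j−r)/2}` for `n ≤ r + j`, `r + j − n` even, else `0` — as printed; the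
  printed upper constraint `r ≤ n + j` is automatic, `transformMatrix_eq_zero_of_lt`), the unitriangular
  lower half (`coeff_transform_add_natDegree` : `a_{n + deg h} = lead(h)`; `coeff_transform_eq_zero_of_lt`),
  degrees (`natDegree_transform_le`, `natDegree_transform_eq`, `monic_transform`).
* §3 `q`-PALINDROMICITY of the transform (`transform_pal` : `a_{n−r} = q^r a_{n+r}`) and the printed
  «equivalently `q^{−n}x^{2n}p(q/x) = p(x)`» in polynomial form: `reflect (2n) (p ∘ (qX)) = q^n · p`
  (`reflect_comp_C_mul_X_of_pal`; converse `pal_of_reflect_comp_C_mul_X` for `q` a non-zero-divisor —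
  over a general ring the coefficient form is the stronger one).
* §4 **PROPOSITION 36, first part**: every `q`-palindromic `p` of degree `≤ 2n` is `𝒯_{q,n}(h)` for a
  UNIQUE `h` of degree `≤ n` (`exists_eq_transform`, `transform_injective`, `existsUnique_eq_transform`),
  monic of degree `2n` iff `h` is monic of degree `n` (`existsUnique_monic_eq_transform`); and
  INTEGRALITY — the matrix `B = (lower half of A)⁻¹` is integral —: if `p = 𝒯_{q,n}(h)` and the
  coefficients of `p` and `q` lie in a subring `S` (more generally in the image of an injective ring map)
  then so do the coefficients of `h` (`exists_map_eq_of_transform_eq_map`, `forall_coeff_mem_iff`,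
  **`forall_coeff_mem_range_intCast_iff`** : «`p(x)` has integer coefficients iff `h(x)` has»).
* §5 multiplicativity `𝒯_{q,n₁+n₂}(h₁h₂) = 𝒯_{q,n₁}(h₁)·𝒯_{q,n₂}(h₂)` (`transform_mul`), linear factors
  `𝒯_{q,1}(X − β) = X² − βX + q` (`transform_X_sub_C`), hence for split `h = ∏(X − β_i)`:
  `p = ∏ (X² − β_i X + q)` (`transform_multiset_prod_X_sub_C`) — the printed
  `p(x) = ∏ (x − α_j)(x − q/α_j)`, `h(x) = ∏ (x − (α_j + q/α_j))`.
* §6 evaluation and roots: `eval_transform` (`p(x) = xⁿ·h(x + q x⁻¹)` for units), over a field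
  `eval_transform_of_ne_zero`, `isRoot_transform_iff` (for `q ≠ 0`, `h` monic: `p(α) = 0 ⟺ α ≠ 0 ∧
  h(α + q/α) = 0`), `isRoot_transform_div` (`α` a root ⟹ `q/α` a root — «for every root `π` of `p(x)` the
  number `qπ⁻¹` is also a root»), `isRoot_transform_of_quadratic` (a root `β` of `h` and a root `α` of
  `x² − βx + q` give a root of `p`).

NOT here (sequel rows): Proposition 36 (1)–(3) (Weil `q`-polynomials versus totally real `h`, the bound
`|β_i| < 2√q`, ordinarity), Lemma 37 (tree: `Literature.LinearAlgebra.Matrix.SymplecticSimilitudeCharpoly`),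
Proposition 38.

## References
* [GoreskyTai2017RealStructuresOrdinary] M. Goresky, Y.-S. Tai, Real structures on ordinary Abelian
  varieties, arXiv:1701.07742 (2017), App. §16.1–§16.2, Proposition 36 with proof (p0036–p0037).
* [Howe2021] E. W. Howe, Deducing information about curves over finite fields from their Weil
  polynomials, arXiv:2110.04221, §1 p. 2 «there is a monic polynomial `h ∈ ℤ[x]` of degree `g` such that
  `f(x) = x^g h(x + q/x)`; this polynomial `h` is known as the real Weil polynomial» — the same convention
  (the source cites [Howe–Lauter]); context only, nothing of it is restated here.
-/

open Polynomial Finset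
open scoped LaurentPolynomial

namespace Literature.Algebra.Polynomial.QPalindromicRealCounterpart

variable {R : Type*} [CommRing R]

/-! ## §1 The transform `𝒯_{q,n}(h) = Σ_{j ≤ n} b_j X^{n−j} (X² + q)^j` is `xⁿ h(x + q/x)` -/

/-- In the Laurent polynomial ring, `T + q·T⁻¹ = T⁻¹ · (T² + q)`. [folklore] -/
private theorem T_one_add_C_mul_T_neg_one (q : R) :
    (LaurentPolynomial.T 1 + LaurentPolynomial.C q * LaurentPolynomial.T (-1) : R[T;T⁻¹]) =
      LaurentPolynomial.T (-1) * (LaurentPolynomial.T 2 + LaurentPolynomial.C q) := by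
  rw [mul_add, ← LaurentPolynomial.T_add, mul_comm (LaurentPolynomial.T (-1))]
  norm_num

/-- **The transform is the printed `p(x) = xⁿ h(x + q/x)`.**  For `deg h ≤ n`, in `R[T;T⁻¹]`:
`toLaurent (Σ_{j ≤ n} b_j X^{n−j}(X²+q)^j) = Tⁿ · h(T + q T⁻¹)`.
[cite: GoreskyTai2017RealStructuresOrdinary, App. §16.2 «or equivalently, p(x) = xⁿh(x + q/x)» (p0036)] -/
theorem toLaurent_transform (q : R) (n : ℕ) (h : R[X]) (hn : h.natDegree ≤ n) :
    toLaurent (∑ j ∈ Finset.range (n + 1), C (h.coeff j) * X ^ (n - j) * (X ^ 2 + C q) ^ j) =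
      LaurentPolynomial.T n *
        aeval (LaurentPolynomial.T 1 + LaurentPolynomial.C q * LaurentPolynomial.T (-1)) h := by
  conv_rhs => rw [h.as_sum_range' (n + 1) (Nat.lt_succ_of_le hn)]
  simp only [map_sum, map_mul, map_pow, map_add, Finset.mul_sum, toLaurent_C, toLaurent_X,
    aeval_monomial, LaurentPolynomial.T_pow, mul_one]
  refine Finset.sum_congr rfl fun j hj => ?_
  have hj' : j ≤ n := Nat.lt_succ_iff.mp (Finset.mem_range.mp hj)
  rw [← LaurentPolynomial.C_eq_algebraMap, T_one_add_C_mul_T_neg_one, mul_pow,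
    LaurentPolynomial.T_pow, Nat.cast_sub hj']
  have hT : LaurentPolynomial.T (n : ℤ) * LaurentPolynomial.T ((j : ℤ) * (-1)) =
      (LaurentPolynomial.T ((n : ℤ) - j) : R[T;T⁻¹]) := by
    rw [← LaurentPolynomial.T_add]; congr 1; ring
  rw [← hT]; ring

/-- Additivity of the transform in `h` (the printed coefficient map `b ↦ a = A·b` is linear). [cite: GoreskyTai2017RealStructuresOrdinary, App. §16.2 Prop. 36 «a_t = Σ_{k=0}^{n} A_{tk} b_k» — the transform is linear in the coefficients of h (p0036)] -/
theorem transform_add (q : R) (n : ℕ) (h₁ h₂ : R[X]) :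
    (∑ j ∈ Finset.range (n + 1), C ((h₁ + h₂).coeff j) * X ^ (n - j) * (X ^ 2 + C q) ^ j) =
      (∑ j ∈ Finset.range (n + 1), C (h₁.coeff j) * X ^ (n - j) * (X ^ 2 + C q) ^ j) +
        ∑ j ∈ Finset.range (n + 1), C (h₂.coeff j) * X ^ (n - j) * (X ^ 2 + C q) ^ j := by
  rw [← Finset.sum_add_distrib]
  refine Finset.sum_congr rfl fun j _ => ?_
  rw [coeff_add, C_add]; ring

/-- The transform of a difference (linearity of `b ↦ A·b`). [cite: GoreskyTai2017RealStructuresOrdinary, App. §16.2 Prop. 36 «a_t = Σ_{k=0}^{n} A_{tk} b_k» — the transform is linear in the coefficients of h (p0036)] -/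
theorem transform_sub (q : R) (n : ℕ) (h₁ h₂ : R[X]) :
    (∑ j ∈ Finset.range (n + 1), C ((h₁ - h₂).coeff j) * X ^ (n - j) * (X ^ 2 + C q) ^ j) =
      (∑ j ∈ Finset.range (n + 1), C (h₁.coeff j) * X ^ (n - j) * (X ^ 2 + C q) ^ j) -
        ∑ j ∈ Finset.range (n + 1), C (h₂.coeff j) * X ^ (n - j) * (X ^ 2 + C q) ^ j := by
  rw [← Finset.sum_sub_distrib]
  refine Finset.sum_congr rfl fun j _ => ?_
  rw [coeff_sub, C_sub]; ring

/-- The transform of zero is zero (linearity of `b ↦ A·b`). [cite: GoreskyTai2017RealStructuresOrdinary, App. §16.2 Prop. 36 «a_t = Σ_{k=0}^{n} A_{tk} b_k» — the transform is linear in the coefficients of h (p0036)] -/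
theorem transform_zero (q : R) (n : ℕ) :
    (∑ j ∈ Finset.range (n + 1), C ((0 : R[X]).coeff j) * X ^ (n - j) * (X ^ 2 + C q) ^ j) = 0 := by
  simp

/-- The transform of a monomial `c·X^k` (`k ≤ n`) is `c · X^{n−k} · (X² + q)^k`.
[cite: GoreskyTai2017RealStructuresOrdinary, App. §16.2 proof of Prop. 36 «p(x) = Σ_j b_j Σ_t C(j,t) q^{j−t} x^{n−j+2t}» (p0036)] -/
theorem transform_C_mul_X_pow (q : R) (n : ℕ) (c : R) {k : ℕ} (hk : k ≤ n) :
    (∑ j ∈ Finset.range (n + 1), C ((C c * X ^ k).coeff j) * X ^ (n - j) * (X ^ 2 + C q) ^ j) =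
      C c * X ^ (n - k) * (X ^ 2 + C q) ^ k := by
  rw [Finset.sum_eq_single k]
  · rw [coeff_C_mul, coeff_X_pow_self, mul_one]
  · intro j _ hjk
    rw [coeff_C_mul, coeff_X_pow, if_neg hjk, mul_zero, C_0, zero_mul, zero_mul]
  · intro hk'
    exact absurd (Finset.mem_range.mpr (Nat.lt_succ_of_le hk)) hk'

/-- The transform of a constant `c` is `c · Xⁿ` (`xⁿ·h(x + q/x)` for the constant `h = c`). [cite: GoreskyTai2017RealStructuresOrdinary, App. §16.2 «p(x) = xⁿh(x + q/x)» ∕ proof of Prop. 36 «A_{rj} = C(j,(r+j−n)/2) q^{(n−r+j)/2}» with j = 0 (p0036)] -/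
theorem transform_C (q : R) (n : ℕ) (c : R) :
    (∑ j ∈ Finset.range (n + 1), C ((C c).coeff j) * X ^ (n - j) * (X ^ 2 + C q) ^ j) =
      C c * X ^ n := by
  have h := transform_C_mul_X_pow q n c (Nat.zero_le n)
  simpa using h

/-- The transform commutes with ring homomorphisms (its matrix is integral).
[cite: GoreskyTai2017RealStructuresOrdinary, App. §16.2 Prop. 36 «universal … integer matrix A» (p0036)] -/
theorem transform_map {S : Type*} [CommRing S] (f : R →+* S) (q : R) (n : ℕ) (h : R[X]) :
    (∑ j ∈ Finset.range (n + 1), C (h.coeff j) * X ^ (n - j) * (X ^ 2 + C q) ^ j).map f =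
      ∑ j ∈ Finset.range (n + 1), C ((h.map f).coeff j) * X ^ (n - j) * (X ^ 2 + C (f q)) ^ j := by
  simp [Polynomial.map_sum, Polynomial.map_mul, Polynomial.map_pow, coeff_map]

/-! ## §2 The universal matrix `A`: coefficients and degrees of the transform -/

/-- `(X² + q)^j = expand₂ ((X + q)^j)`. [folklore] -/
private theorem X_sq_add_C_pow_eq_expand (q : R) (j : ℕ) :
    ((X : R[X]) ^ 2 + C q) ^ j = expand R 2 ((X + C q) ^ j) := by
  rw [map_pow, map_add, expand_X, expand_C]

/-- The coefficients of `(X² + q)^j`: `C(j, k/2) · q^{j − k/2}` at even `k`, zero at odd `k`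
(for `k/2 > j` the binomial coefficient vanishes). [cite: GoreskyTai2017RealStructuresOrdinary, App. §16.2 proof of Prop. 36 (the binomial expansion of `(x + q/x)^j`) (p0036)] -/
theorem coeff_X_sq_add_C_pow (q : R) (j k : ℕ) :
    (((X : R[X]) ^ 2 + C q) ^ j).coeff k =
      if Even k then q ^ (j - k / 2) * (j.choose (k / 2) : R) else 0 := by
  rw [X_sq_add_C_pow_eq_expand, coeff_expand two_pos, coeff_X_add_C_pow]
  simp only [even_iff_two_dvd]

/-- The coefficients of `X^m · (X² + q)^j` (the printed binomial expansion `Σ_t C(j,t) q^{j−t} x^{m+2t}`). [cite: GoreskyTai2017RealStructuresOrdinary, App. §16.2 proof of Prop. 36 «= Σ_j b_j Σ_{t=0}^{j} C(j,t) q^{j−t} x^{n−j+2t}» (p0036)] -/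
theorem coeff_X_pow_mul_X_sq_add_C_pow (q : R) (m j r : ℕ) :
    ((X : R[X]) ^ m * (X ^ 2 + C q) ^ j).coeff r =
      if m ≤ r ∧ Even (r - m) then q ^ (j - (r - m) / 2) * (j.choose ((r - m) / 2) : R) else 0 := by
  rw [coeff_X_pow_mul', coeff_X_sq_add_C_pow]
  by_cases hm : m ≤ r
  · by_cases he : Even (r - m)
    · rw [if_pos hm, if_pos he, if_pos ⟨hm, he⟩]
    · rw [if_pos hm, if_neg he, if_neg (fun h => he h.2)]
  · rw [if_neg hm, if_neg (fun h => hm h.1)]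

/-- **Proposition 36 (the matrix `A`).**  The coefficient `a_r` of `𝒯_{q,n}(h) = Σ_j b_j X^{n−j}(X²+q)^j`
is `Σ_{j ≤ n} A_{rj} b_j` with `A_{rj} = C(j, (r+j−n)/2) · q^{(n+j−r)/2}` when `n ≤ r + j` and `r + j − n`
is even, and `A_{rj} = 0` otherwise (the printed constraint `r ≤ n + j` is then automatic: for
`r > n + j` the binomial coefficient vanishes, `transformMatrix_eq_zero_of_lt`).
[cite: GoreskyTai2017RealStructuresOrdinary, App. §16.2 Prop. 36 and proof «A_{rj} = C(j,(r+j−n)/2) q^{(n−r+j)/2}» (p0036)] -/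
theorem coeff_transform (q : R) (n : ℕ) (h : R[X]) (r : ℕ) :
    (∑ j ∈ Finset.range (n + 1), C (h.coeff j) * X ^ (n - j) * (X ^ 2 + C q) ^ j).coeff r =
      ∑ j ∈ Finset.range (n + 1),
        (if n ≤ r + j ∧ Even (r + j - n) then
            q ^ ((n + j - r) / 2) * (j.choose ((r + j - n) / 2) : R) else 0) * h.coeff j := by
  rw [finsetSum_coeff]
  refine Finset.sum_congr rfl fun j hj => ?_
  have hj' : j ≤ n := Nat.lt_succ_iff.mp (Finset.mem_range.mp hj)
  rw [mul_assoc, coeff_C_mul, coeff_X_pow_mul_X_sq_add_C_pow, mul_comm]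
  congr 1
  have e1 : (n - j ≤ r) ↔ (n ≤ r + j) := by omega
  by_cases hc : n ≤ r + j
  · have e2 : r - (n - j) = r + j - n := by omega
    rw [e2]
    by_cases he : Even (r + j - n)
    · rw [if_pos ⟨e1.mpr hc, he⟩, if_pos ⟨hc, he⟩]
      obtain ⟨t, ht⟩ := he
      have e3 : j - (r + j - n) / 2 = (n + j - r) / 2 := by omega
      rw [e3]
    · rw [if_neg (fun h => he h.2), if_neg (fun h => he h.2)]
  · rw [if_neg (fun h => hc (e1.mp h.1)), if_neg (fun h => hc h.1)]

/-- The printed constraint `r ≤ n + j` is automatic: for `r > n + j` the entry `A_{rj}` vanishes.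
[cite: GoreskyTai2017RealStructuresOrdinary, App. §16.2 proof of Prop. 36 «provided that … n − j ≤ r ≤ n + j, and A_{rj} = 0 otherwise» (p0036)] -/
theorem transformMatrix_eq_zero_of_lt (q : R) {n j r : ℕ} (hr : n + j < r) :
    (if n ≤ r + j ∧ Even (r + j - n) then
        q ^ ((n + j - r) / 2) * (j.choose ((r + j - n) / 2) : R) else 0) = 0 := by
  split_ifs with hc
  · obtain ⟨t, ht⟩ := hc.2
    have hlt : j < (r + j - n) / 2 := by omega
    rw [Nat.choose_eq_zero_of_lt hlt, Nat.cast_zero, mul_zero]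
  · rfl

/-- The diagonal of the lower half: `A_{n+s,s} = 1`.
[cite: GoreskyTai2017RealStructuresOrdinary, App. §16.2 proof of Prop. 36 «A_{n+s,s} = 1 for all 0 ≤ s ≤ n» (p0036)] -/
theorem transformMatrix_diag (q : R) (n s : ℕ) :
    (if n ≤ (n + s) + s ∧ Even ((n + s) + s - n) then
        q ^ ((n + s - (n + s)) / 2) * (s.choose (((n + s) + s - n) / 2) : R) else 0) = 1 := by
  have h1 : (n + s) + s - n = 2 * s := by omega
  rw [if_pos ⟨by omega, by rw [h1]; exact even_two_mul s⟩, h1, Nat.sub_self]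
  simp

/-- The lower half of `A` is (uni)triangular: `A_{n+s,j} = 0` for `j < s`.
[cite: GoreskyTai2017RealStructuresOrdinary, App. §16.2 proof of Prop. 36 «the lower half of the matrix A is nonsingular with determinant equal to 1» (p0036)] -/
theorem transformMatrix_eq_zero_of_lt' (q : R) {n s j : ℕ} (hj : j < s) :
    (if n ≤ (n + s) + j ∧ Even ((n + s) + j - n) then
        q ^ ((n + j - (n + s)) / 2) * (j.choose (((n + s) + j - n) / 2) : R) else 0) = 0 :=
  transformMatrix_eq_zero_of_lt q (by omega)

/-- Coefficients of the transform above `n + deg h` vanish (`A_{rj} = 0` unless `r ≤ n + j`). [cite: GoreskyTai2017RealStructuresOrdinary, App. §16.2 proof of Prop. 36 «provided that … n − j ≤ r ≤ n + j, and A_{rj} = 0 otherwise» (p0036)] -/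
theorem coeff_transform_eq_zero_of_lt (q : R) (n : ℕ) (h : R[X]) {r : ℕ}
    (hr : n + h.natDegree < r) :
    (∑ j ∈ Finset.range (n + 1), C (h.coeff j) * X ^ (n - j) * (X ^ 2 + C q) ^ j).coeff r = 0 := by
  rw [coeff_transform]
  refine Finset.sum_eq_zero fun j _ => ?_
  by_cases hjd : j ≤ h.natDegree
  · rw [transformMatrix_eq_zero_of_lt q (by omega), zero_mul]
  · rw [coeff_eq_zero_of_natDegree_lt (not_le.mp hjd), mul_zero]

/-- Coefficients of the transform below `n − deg h` vanish (`A_{rj} = 0` unless `n − j ≤ r`). [cite: GoreskyTai2017RealStructuresOrdinary, App. §16.2 proof of Prop. 36 «provided that … n − j ≤ r ≤ n + j, and A_{rj} = 0 otherwise» (p0036)] -/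
theorem coeff_transform_eq_zero_of_lt_sub (q : R) (n : ℕ) (h : R[X]) {r : ℕ}
    (hr : r + h.natDegree < n) :
    (∑ j ∈ Finset.range (n + 1), C (h.coeff j) * X ^ (n - j) * (X ^ 2 + C q) ^ j).coeff r = 0 := by
  rw [coeff_transform]
  refine Finset.sum_eq_zero fun j _ => ?_
  by_cases hjd : j ≤ h.natDegree
  · rw [if_neg (by rintro ⟨hc, -⟩; omega), zero_mul]
  · rw [coeff_eq_zero_of_natDegree_lt (not_le.mp hjd), mul_zero]

/-- **The lower half of `A` is unitriangular**: the coefficient of `𝒯_{q,n}(h)` in degree `n + deg h`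
is the leading coefficient of `h`. [cite: GoreskyTai2017RealStructuresOrdinary, App. §16.2 proof of Prop. 36 «A_{n+s,s} = 1 … the lower half of the matrix A is nonsingular with determinant equal to 1» (p0036)] -/
theorem coeff_transform_add_natDegree (q : R) (n : ℕ) (h : R[X]) :
    (∑ j ∈ Finset.range (n + 1), C (h.coeff j) * X ^ (n - j) * (X ^ 2 + C q) ^ j).coeff
        (n + h.natDegree) = if h.natDegree ≤ n then h.leadingCoeff else 0 := by
  rw [coeff_transform]
  split_ifs with hd
  · rw [Finset.sum_eq_single h.natDegree]
    · rw [transformMatrix_diag, one_mul, leadingCoeff]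
    · intro j _ hj
      rcases lt_or_gt_of_ne hj with hj | hj
      · rw [transformMatrix_eq_zero_of_lt' q hj, zero_mul]
      · rw [coeff_eq_zero_of_natDegree_lt hj, mul_zero]
    · intro hn
      exact absurd (Finset.mem_range.mpr (Nat.lt_succ_of_le hd)) hn
  · refine Finset.sum_eq_zero fun j hj => ?_
    have hj' : j ≤ n := Nat.lt_succ_iff.mp (Finset.mem_range.mp hj)
    rw [transformMatrix_eq_zero_of_lt q (by omega), zero_mul]

/-- `deg 𝒯_{q,n}(h) ≤ n + deg h` (`A_{rj} = 0` unless `r ≤ n + j`). [cite: GoreskyTai2017RealStructuresOrdinary, App. §16.2 proof of Prop. 36 «n − j ≤ r ≤ n + j, and A_{rj} = 0 otherwise» (p0036)] -/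
theorem natDegree_transform_le (q : R) (n : ℕ) (h : R[X]) :
    (∑ j ∈ Finset.range (n + 1), C (h.coeff j) * X ^ (n - j) * (X ^ 2 + C q) ^ j).natDegree ≤
      n + h.natDegree :=
  natDegree_le_iff_coeff_eq_zero.mpr fun _ hr => coeff_transform_eq_zero_of_lt q n h hr

/-- `deg 𝒯_{q,n}(h) ≤ 2n` for `deg h ≤ n`. [cite: GoreskyTai2017RealStructuresOrdinary, App. §16.2 (p has degree 2n) (p0036)] -/
theorem natDegree_transform_le_two_mul (q : R) (n : ℕ) (h : R[X]) (hn : h.natDegree ≤ n) :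
    (∑ j ∈ Finset.range (n + 1), C (h.coeff j) * X ^ (n - j) * (X ^ 2 + C q) ^ j).natDegree ≤
      2 * n :=
  (natDegree_transform_le q n h).trans (by omega)

/-- `deg 𝒯_{q,n}(h) = n + deg h` for `h ≠ 0` of degree `≤ n` (`A_{n+s,s} = 1`, `A_{rj} = 0` for `r > n + j`). [cite: GoreskyTai2017RealStructuresOrdinary, App. §16.2 proof of Prop. 36 «A_{n+s,s} = 1 for all 0 ≤ s ≤ n» (p0036)] -/
theorem natDegree_transform_eq (q : R) (n : ℕ) {h : R[X]} (h0 : h ≠ 0) (hn : h.natDegree ≤ n) :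
    (∑ j ∈ Finset.range (n + 1), C (h.coeff j) * X ^ (n - j) * (X ^ 2 + C q) ^ j).natDegree =
      n + h.natDegree := by
  refine le_antisymm (natDegree_transform_le q n h) (le_natDegree_of_ne_zero ?_)
  rw [coeff_transform_add_natDegree, if_pos hn]
  exact leadingCoeff_ne_zero.mpr h0

/-- **`p` is monic of degree `2n` when `h` is monic of degree `n`.**
[cite: GoreskyTai2017RealStructuresOrdinary, App. §16.2 «a monic polynomial p(x) = x^{2n} + …» ∕ «h(x) = ∏ (x − (α_j + q/α_j))» (p0036)] -/
theorem monic_transform (q : R) (n : ℕ) {h : R[X]} (hm : h.Monic) (hn : h.natDegree = n) :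
    (∑ j ∈ Finset.range (n + 1), C (h.coeff j) * X ^ (n - j) * (X ^ 2 + C q) ^ j).Monic ∧
      (∑ j ∈ Finset.range (n + 1), C (h.coeff j) * X ^ (n - j) * (X ^ 2 + C q) ^ j).natDegree =
        2 * n := by
  rcases subsingleton_or_nontrivial R with hR | hR
  · have h0 : n = 0 := by rw [← hn]; exact natDegree_of_subsingleton
    subst h0
    exact ⟨monic_of_subsingleton _, natDegree_of_subsingleton⟩
  have hd := natDegree_transform_eq q n hm.ne_zero hn.le
  refine ⟨?_, by rw [hd, hn]; ring⟩
  rw [Monic, leadingCoeff, hd, coeff_transform_add_natDegree, if_pos hn.le, hm.leadingCoeff]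

/-! ## §3 `q`-palindromicity -/

/-- `X^{n−j}(X²+q)^j` is `q`-palindromic of degree `2n` (centre `n`). [folklore] -/
private theorem coeff_X_pow_mul_X_sq_add_C_pow_pal (q : R) {n j r : ℕ} (hj : j ≤ n) (hr : r ≤ n) :
    ((X : R[X]) ^ (n - j) * (X ^ 2 + C q) ^ j).coeff (n - r) =
      q ^ r * ((X : R[X]) ^ (n - j) * (X ^ 2 + C q) ^ j).coeff (n + r) := by
  rw [coeff_X_pow_mul_X_sq_add_C_pow, coeff_X_pow_mul_X_sq_add_C_pow]
  by_cases hrj : r ≤ j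
  · have e1 : n - r - (n - j) = j - r := by omega
    have e2 : n + r - (n - j) = j + r := by omega
    rw [e1, e2]
    by_cases he : Even (j - r)
    · have he' : Even (j + r) := by
        obtain ⟨t, ht⟩ := he
        exact ⟨t + r, by omega⟩
      rw [if_pos ⟨by omega, he⟩, if_pos ⟨by omega, he'⟩]
      obtain ⟨t, ht⟩ := he
      have e3 : j - r = 2 * t := by omega
      have e4 : j + r = 2 * (t + r) := by omega
      rw [e3, e4, Nat.mul_div_cancel_left _ two_pos, Nat.mul_div_cancel_left _ two_pos,
        Nat.choose_symm_of_eq_add (show j = t + (t + r) by omega)]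
      have e5 : j - t = r + (j - (t + r)) := by omega
      rw [e5, pow_add]; ring
    · have he' : ¬ Even (j + r) := by
        rintro ⟨t, ht⟩
        exact he ⟨t - r, by omega⟩
      rw [if_neg (fun h => he h.2), if_neg (fun h => he' h.2), mul_zero]
  · rw [not_le] at hrj
    rw [if_neg (by rintro ⟨h1, -⟩; omega)]
    by_cases hc : n - j ≤ n + r ∧ Even (n + r - (n - j))
    · rw [if_pos hc]
      obtain ⟨t, ht⟩ := hc.2
      have hlt : j < (n + r - (n - j)) / 2 := by omega
      rw [Nat.choose_eq_zero_of_lt hlt, Nat.cast_zero, mul_zero, mul_zero]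
    · rw [if_neg hc, mul_zero]

/-- **The transform is `q`-palindromic**: `a_{n−r} = q^r · a_{n+r}` for `r ≤ n`.
[cite: GoreskyTai2017RealStructuresOrdinary, App. §16.2 «q-palindromic if … a_{n−r} = q^r a_{n+r} for 1 ≤ r ≤ n» ∕ Lemma 37 (p0036–p0037)] -/
theorem transform_pal (q : R) (n : ℕ) (h : R[X]) {r : ℕ} (hr : r ≤ n) :
    (∑ j ∈ Finset.range (n + 1), C (h.coeff j) * X ^ (n - j) * (X ^ 2 + C q) ^ j).coeff (n - r) =
      q ^ r *
        (∑ j ∈ Finset.range (n + 1), C (h.coeff j) * X ^ (n - j) * (X ^ 2 + C q) ^ j).coeff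
          (n + r) := by
  rw [finsetSum_coeff, finsetSum_coeff, Finset.mul_sum]
  refine Finset.sum_congr rfl fun j hj => ?_
  have hj' : j ≤ n := Nat.lt_succ_iff.mp (Finset.mem_range.mp hj)
  rw [mul_assoc, coeff_C_mul, coeff_C_mul, coeff_X_pow_mul_X_sq_add_C_pow_pal q hj' hr]
  ring

/-- `q`-palindromic polynomials (centre `n`) are closed under subtraction. [folklore] -/
private theorem pal_sub {q : R} {n : ℕ} {p₁ p₂ : R[X]}
    (h₁ : ∀ r ≤ n, p₁.coeff (n - r) = q ^ r * p₁.coeff (n + r))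
    (h₂ : ∀ r ≤ n, p₂.coeff (n - r) = q ^ r * p₂.coeff (n + r)) :
    ∀ r ≤ n, (p₁ - p₂).coeff (n - r) = q ^ r * (p₁ - p₂).coeff (n + r) := by
  intro r hr
  rw [coeff_sub, coeff_sub, h₁ r hr, h₂ r hr, mul_sub]

/-- A `q`-palindromic polynomial of degree `≤ n` (centre `n`) is the monomial `a_n Xⁿ`. [folklore] -/
private theorem eq_C_mul_X_pow_of_pal {q : R} {n : ℕ} {p : R[X]} (hp : p.natDegree ≤ n)
    (hpal : ∀ r ≤ n, p.coeff (n - r) = q ^ r * p.coeff (n + r)) : p = C (p.coeff n) * X ^ n := by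
  ext k
  rw [coeff_C_mul, coeff_X_pow]
  split_ifs with hk
  · rw [hk, mul_one]
  · rcases lt_or_gt_of_ne hk with hk | hk
    · have := hpal (n - k) (Nat.sub_le n k)
      rw [Nat.sub_sub_self hk.le] at this
      rw [this, coeff_eq_zero_of_natDegree_lt (by omega), mul_zero, mul_zero]
    · rw [coeff_eq_zero_of_natDegree_lt (by omega), mul_zero]

/-- **«equivalently `q^{−n} x^{2n} p(q/x) = p(x)`»**, polynomial form: a `q`-palindromic `p` of degree
`≤ 2n` satisfies `reflect (2n) (p ∘ (q·X)) = q^n · p` (note `x^{2n} p(q/x) = reflect_{2n}(p(qx))`).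
[cite: GoreskyTai2017RealStructuresOrdinary, App. §16.2 «or equivalently if q^{−n} x^{2n} p(q/x) = p(x)» (p0036)] -/
theorem reflect_comp_C_mul_X_of_pal {q : R} {n : ℕ} {p : R[X]} (hp : p.natDegree ≤ 2 * n)
    (hpal : ∀ r ≤ n, p.coeff (n - r) = q ^ r * p.coeff (n + r)) :
    (p.comp (C q * X)).reflect (2 * n) = C (q ^ n) * p := by
  ext k
  rw [coeff_reflect, coeff_C_mul]
  by_cases hk : k ≤ 2 * n
  · rw [revAt_le hk, comp_C_mul_X_coeff]
    rcases le_total k n with hkn | hkn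
    · have h1 := hpal (n - k) (Nat.sub_le n k)
      rw [Nat.sub_sub_self hkn, show n + (n - k) = 2 * n - k by omega] at h1
      rw [h1, show 2 * n - k = n + (n - k) by omega, pow_add]
      ring
    · have h1 := hpal (k - n) (by omega)
      rw [show n - (k - n) = 2 * n - k by omega, show n + (k - n) = k by omega] at h1
      have e : q ^ n = q ^ (k - n) * q ^ (2 * n - k) := by
        rw [← pow_add]; congr 1; omega
      rw [h1, e]
      ring
  · rw [not_le] at hk
    rw [revAt_eq_self_of_lt hk, comp_C_mul_X_coeff,
      coeff_eq_zero_of_natDegree_lt (lt_of_le_of_lt hp hk), zero_mul, mul_zero]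

/-- Converse, for `q` a non-zero-divisor: `reflect (2n) (p ∘ (q·X)) = q^n · p` implies the coefficient
condition `a_{n−r} = q^r a_{n+r}` (over a general ring the coefficient condition is the stronger one:
for `q = 0`, `n = 1` the polynomial `X` satisfies the former but not the latter).
[cite: GoreskyTai2017RealStructuresOrdinary, App. §16.2 «or equivalently» (p0036)] -/
theorem pal_of_reflect_comp_C_mul_X {q : R} (hq : q ∈ nonZeroDivisors R) {n : ℕ} {p : R[X]}
    (href : (p.comp (C q * X)).reflect (2 * n) = C (q ^ n) * p) :
    ∀ r ≤ n, p.coeff (n - r) = q ^ r * p.coeff (n + r) := by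
  intro r hr
  have hk := congrArg (fun f => f.coeff (n - r)) href
  simp only [coeff_reflect, coeff_C_mul] at hk
  rw [revAt_le (by omega), comp_C_mul_X_coeff, show 2 * n - (n - r) = n + r by omega] at hk
  -- `hk : a_{n+r} q^{n+r} = q^n a_{n−r}`; cancel `q^n`
  have hq' : q ^ n ∈ nonZeroDivisors R := pow_mem hq n
  have : q ^ n * (q ^ r * p.coeff (n + r)) = q ^ n * p.coeff (n - r) := by
    rw [← hk, pow_add]; ring
  exact ((mul_cancel_left_mem_nonZeroDivisors hq').mp this).symm

/-! ## §4 Proposition 36, first part: existence and uniqueness of the real counterpart; integrality -/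

/-- Existence, graded form: a `q`-palindromic `p` (centre `n`) of degree `≤ n + m`, `m ≤ n`, is the
transform of some `h` of degree `≤ m` (downward induction on the top coefficient — the printed
«`B` = inverse of the unitriangular lower half of `A`»). [cite: GoreskyTai2017RealStructuresOrdinary, App. §16.2 Prop. 36 «b_k = Σ_s B_{ks} a_{n+s}» and proof (p0036)] -/
theorem exists_eq_transform_of_le (q : R) (n : ℕ) :
    ∀ m ≤ n, ∀ p : R[X], p.natDegree ≤ n + m →
      (∀ r ≤ n, p.coeff (n - r) = q ^ r * p.coeff (n + r)) →
        ∃ h : R[X], h.natDegree ≤ m ∧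
          p = ∑ j ∈ Finset.range (n + 1), C (h.coeff j) * X ^ (n - j) * (X ^ 2 + C q) ^ j := by
  intro m
  induction m with
  | zero =>
    intro _ p hp hpal
    refine ⟨C (p.coeff n), (natDegree_C _).le.trans le_rfl, ?_⟩
    rw [transform_C]
    exact eq_C_mul_X_pow_of_pal (by simpa using hp) hpal
  | succ m ih =>
    intro hm p hp hpal
    set c := p.coeff (n + (m + 1)) with hc
    set p' := p - C c * X ^ (n - (m + 1)) * (X ^ 2 + C q) ^ (m + 1) with hp'
    have ht := transform_C_mul_X_pow q n c hm
    have hp'deg : p'.natDegree ≤ n + m := by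
      refine natDegree_le_iff_coeff_eq_zero.mpr fun r hr => ?_
      rw [hp', coeff_sub]
      rcases (show n + (m + 1) = r ∨ n + (m + 1) < r by omega) with hr' | hr'
      · -- the top coefficient cancels
        rw [← ht, ← hr']
        have h1 := coeff_transform_add_natDegree q n (C c * X ^ (m + 1))
        by_cases hc0 : c = 0
        · rw [hc0] at h1 ⊢
          simp only [map_zero, zero_mul, coeff_zero, Finset.sum_const_zero, sub_zero]
          rw [← hc, hc0]
        · rw [natDegree_C_mul_X_pow _ _ hc0, if_pos hm, leadingCoeff_C_mul_X_pow] at h1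
          rw [h1, ← hc, sub_self]
      · rw [coeff_eq_zero_of_natDegree_lt (lt_of_le_of_lt hp hr'), ← ht,
          coeff_transform_eq_zero_of_lt q n _ ((Nat.add_le_add_left
            (natDegree_C_mul_X_pow_le c (m + 1)) n).trans_lt hr'), sub_zero]
    have hp'pal : ∀ r ≤ n, p'.coeff (n - r) = q ^ r * p'.coeff (n + r) := by
      rw [hp', ← ht]
      exact pal_sub hpal (fun r hr => transform_pal q n _ hr)
    obtain ⟨h', hh'deg, hh'⟩ := ih (Nat.le_of_succ_le hm) p' hp'deg hp'pal
    refine ⟨h' + C c * X ^ (m + 1), (natDegree_add_le _ _).trans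
      (max_le (hh'deg.trans (Nat.le_succ m)) (natDegree_C_mul_X_pow_le c (m + 1))), ?_⟩
    rw [transform_add, ← hh', ht, hp']
    ring

/-- **Proposition 36, existence half**: every `q`-palindromic polynomial `p` of degree `≤ 2n` is the
transform `Σ_{j ≤ n} b_j X^{n−j}(X²+q)^j` of a polynomial `h = Σ b_j x^j` of degree `≤ n`.
[cite: GoreskyTai2017RealStructuresOrdinary, App. §16.2 Prop. 36 (p0036)] -/
theorem exists_eq_transform (q : R) (n : ℕ) (p : R[X]) (hp : p.natDegree ≤ 2 * n)
    (hpal : ∀ r ≤ n, p.coeff (n - r) = q ^ r * p.coeff (n + r)) :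
    ∃ h : R[X], h.natDegree ≤ n ∧
      p = ∑ j ∈ Finset.range (n + 1), C (h.coeff j) * X ^ (n - j) * (X ^ 2 + C q) ^ j :=
  exists_eq_transform_of_le q n n le_rfl p (by omega) hpal

/-- The transform is injective on polynomials of degree `≤ n` (the lower half of `A` has determinant
`1`). [cite: GoreskyTai2017RealStructuresOrdinary, App. §16.2 proof of Prop. 36 «the lower half of the matrix A is nonsingular with determinant equal to 1» (p0036)] -/
theorem transform_injective (q : R) (n : ℕ) {h₁ h₂ : R[X]} (hn₁ : h₁.natDegree ≤ n)
    (hn₂ : h₂.natDegree ≤ n)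
    (heq : (∑ j ∈ Finset.range (n + 1), C (h₁.coeff j) * X ^ (n - j) * (X ^ 2 + C q) ^ j) =
      ∑ j ∈ Finset.range (n + 1), C (h₂.coeff j) * X ^ (n - j) * (X ^ 2 + C q) ^ j) :
    h₁ = h₂ := by
  by_contra hne
  have hsub : h₁ - h₂ ≠ 0 := sub_ne_zero.mpr hne
  have hdeg : (h₁ - h₂).natDegree ≤ n := (natDegree_sub_le _ _).trans (max_le hn₁ hn₂)
  have h0 : (∑ j ∈ Finset.range (n + 1),
      C ((h₁ - h₂).coeff j) * X ^ (n - j) * (X ^ 2 + C q) ^ j) = 0 := by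
    rw [transform_sub, heq, sub_self]
  have h1 := coeff_transform_add_natDegree q n (h₁ - h₂)
  rw [h0, coeff_zero, if_pos hdeg] at h1
  exact hsub (leadingCoeff_eq_zero.mp h1.symm)

/-- **Proposition 36, first part (existence and uniqueness of the real counterpart).**
[cite: GoreskyTai2017RealStructuresOrdinary, App. §16.2 Prop. 36 (p0036)] -/
theorem existsUnique_eq_transform (q : R) (n : ℕ) (p : R[X]) (hp : p.natDegree ≤ 2 * n)
    (hpal : ∀ r ≤ n, p.coeff (n - r) = q ^ r * p.coeff (n + r)) :
    ∃! h : R[X], h.natDegree ≤ n ∧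
      p = ∑ j ∈ Finset.range (n + 1), C (h.coeff j) * X ^ (n - j) * (X ^ 2 + C q) ^ j := by
  obtain ⟨h, hh, hp⟩ := exists_eq_transform q n p hp hpal
  exact ⟨h, ⟨hh, hp⟩, fun h' hh' => transform_injective q n hh'.1 hh (hh'.2.symm.trans hp)⟩

/-- The top coefficient of the counterpart: if `p = 𝒯_{q,n}(h)` with `deg h ≤ n` then
`lead(h) = a_{n + deg h}`; in particular `h` is monic of degree `n` iff `p` is monic of degree `2n`.
[cite: GoreskyTai2017RealStructuresOrdinary, App. §16.2 proof of Prop. 36 «A_{n+s,s} = 1» (p0036)] -/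
theorem monic_iff_of_eq_transform (q : R) (n : ℕ) {p h : R[X]} (hn : h.natDegree ≤ n)
    (hp : p = ∑ j ∈ Finset.range (n + 1), C (h.coeff j) * X ^ (n - j) * (X ^ 2 + C q) ^ j) :
    (h.Monic ∧ h.natDegree = n) ↔ (p.Monic ∧ p.natDegree = 2 * n) := by
  rcases subsingleton_or_nontrivial R with hR | hR
  · have e1 : h.natDegree = 0 := natDegree_of_subsingleton
    have e2 : p.natDegree = 0 := natDegree_of_subsingleton
    simp only [monic_of_subsingleton, true_and, e1, e2]
    omega
  constructor
  · rintro ⟨hm, hd⟩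
    rw [hp]; exact monic_transform q n hm hd
  · rintro ⟨pm, pd⟩
    have h0 : h ≠ 0 := by
      rintro rfl
      rw [transform_zero] at hp
      rw [hp, natDegree_zero] at pd
      rw [hp] at pm
      exact Monic.ne_zero pm rfl
    have hd' := natDegree_transform_eq q n h0 hn
    rw [← hp, pd] at hd'
    have hd : h.natDegree = n := by omega
    refine ⟨?_, hd⟩
    have h1 := coeff_transform_add_natDegree q n h
    rw [← hp, if_pos hn, hd, ← two_mul, ← pd] at h1
    rw [Monic, ← h1]; exact pm

/-- **Proposition 36 for monic polynomials**: a monic `q`-palindromic `p` of degree `2n` is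
`xⁿ h(x + q/x)` for a unique monic `h` of degree `n`.
[cite: GoreskyTai2017RealStructuresOrdinary, App. §16.2 Prop. 36 (p0036)] -/
theorem existsUnique_monic_eq_transform (q : R) (n : ℕ) (p : R[X]) (hm : p.Monic)
    (hp : p.natDegree = 2 * n) (hpal : ∀ r ≤ n, p.coeff (n - r) = q ^ r * p.coeff (n + r)) :
    ∃! h : R[X], (h.Monic ∧ h.natDegree = n) ∧
      p = ∑ j ∈ Finset.range (n + 1), C (h.coeff j) * X ^ (n - j) * (X ^ 2 + C q) ^ j := by
  obtain ⟨h, ⟨hh, hph⟩, huniq⟩ := existsUnique_eq_transform q n p hp.le hpal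
  refine ⟨h, ⟨(monic_iff_of_eq_transform q n hh hph).mpr ⟨hm, hp⟩, hph⟩, fun h' hh' => ?_⟩
  exact huniq h' ⟨hh'.1.2.le, hh'.2⟩

/-- **Integrality (the matrix `B` is integral)**, ring-map form: if `p = 𝒯_{q,n}(h)` over `R` with
`deg h ≤ n`, and `p`, `q` come from `S` along an INJECTIVE ring map `f : S → R`, then `h` comes from `S`.
[cite: GoreskyTai2017RealStructuresOrdinary, App. §16.2 Prop. 36 «universal … integer matrix B … b_k = Σ B_{ks} a_{n+s}» (p0036)] -/
theorem exists_map_eq_of_transform_eq_map {S : Type*} [CommRing S] {f : S →+* R}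
    (hf : Function.Injective f) (q₀ : S) (n : ℕ) (p₀ : S[X]) {h : R[X]} (hn : h.natDegree ≤ n)
    (hp : p₀.map f = ∑ j ∈ Finset.range (n + 1), C (h.coeff j) * X ^ (n - j) * (X ^ 2 + C (f q₀)) ^ j) :
    ∃ h₀ : S[X], h₀.natDegree ≤ n ∧ h₀.map f = h := by
  have hdeg : p₀.natDegree ≤ 2 * n := by
    rw [← natDegree_map_eq_of_injective hf, hp]; exact natDegree_transform_le_two_mul _ n h hn
  have hpal : ∀ r ≤ n, p₀.coeff (n - r) = q₀ ^ r * p₀.coeff (n + r) := by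
    intro r hr
    apply hf
    rw [map_mul, map_pow, ← coeff_map, ← coeff_map, hp]
    exact transform_pal _ n h hr
  obtain ⟨h₀, hh₀, hp₀⟩ := exists_eq_transform q₀ n p₀ hdeg hpal
  refine ⟨h₀, hh₀, transform_injective (f q₀) n ?_ hn ?_⟩
  · rw [natDegree_map_eq_of_injective hf]; exact hh₀
  · rw [← hp, hp₀, transform_map]

/-- **Integrality, subring form**: for a subring `S ∋ q`, if `p = 𝒯_{q,n}(h)` (`deg h ≤ n`) then all
coefficients of `p` lie in `S` iff all coefficients of `h` do.
[cite: GoreskyTai2017RealStructuresOrdinary, App. §16.2 «If h(x) ∈ ℤ[x] has integer coefficients then the same is true of p(x). The following proposition gives a converse» ∕ Prop. 36 (p0036)] -/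
theorem forall_coeff_mem_iff (S : Subring R) {q : R} (hq : q ∈ S) (n : ℕ) {p h : R[X]}
    (hn : h.natDegree ≤ n)
    (hp : p = ∑ j ∈ Finset.range (n + 1), C (h.coeff j) * X ^ (n - j) * (X ^ 2 + C q) ^ j) :
    (∀ i, p.coeff i ∈ S) ↔ ∀ i, h.coeff i ∈ S := by
  constructor
  · intro hpS
    have hlift : p ∈ lifts S.subtype := by
      rw [lifts_iff_coeff_lifts]; intro i; exact ⟨⟨p.coeff i, hpS i⟩, rfl⟩
    obtain ⟨p₀, hp₀⟩ := (mem_lifts p).mp hlift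
    obtain ⟨h₀, -, hh₀⟩ := exists_map_eq_of_transform_eq_map (f := S.subtype)
      Subtype.coe_injective ⟨q, hq⟩ n p₀ hn (by rw [hp₀, hp]; rfl)
    intro i
    rw [← hh₀, coeff_map]
    exact (h₀.coeff i).2
  · intro hhS i
    rw [hp, finsetSum_coeff]
    refine sum_mem fun j _ => ?_
    rw [mul_assoc, coeff_C_mul]
    refine mul_mem (hhS j) ?_
    rw [coeff_X_pow_mul_X_sq_add_C_pow]
    split_ifs
    · exact mul_mem (pow_mem hq _) (natCast_mem S _)
    · exact zero_mem S

/-- **«In particular, `p(x)` has integer coefficients iff `h(x)` has integer coefficients»** (for an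
integer `q`, over any commutative ring: all coefficients of `p = 𝒯_{q,n}(h)` are integers iff all
coefficients of `h` are). [cite: GoreskyTai2017RealStructuresOrdinary, App. §16.2 Prop. 36 «In particular, p(x) has integer coefficients iff h(x) has integer coefficients» (p0036)] -/
theorem forall_coeff_mem_range_intCast_iff (q : ℤ) (n : ℕ) {p h : R[X]} (hn : h.natDegree ≤ n)
    (hp : p = ∑ j ∈ Finset.range (n + 1),
      C (h.coeff j) * X ^ (n - j) * (X ^ 2 + C (q : R)) ^ j) :
    (∀ i, p.coeff i ∈ (Int.castRingHom R).range) ↔ ∀ i, h.coeff i ∈ (Int.castRingHom R).range :=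
  forall_coeff_mem_iff (Int.castRingHom R).range ⟨q, rfl⟩ n hn hp

/-! ## §5 Multiplicativity and linear factors -/

/-- **Multiplicativity**: `𝒯_{q,n₁+n₂}(h₁h₂) = 𝒯_{q,n₁}(h₁) · 𝒯_{q,n₂}(h₂)` for `deg h_i ≤ n_i`
(immediate from `x^{n₁+n₂}(h₁h₂)(x+q/x) = x^{n₁}h₁(x+q/x) · x^{n₂}h₂(x+q/x)`).
[cite: GoreskyTai2017RealStructuresOrdinary, App. §16.2 «p(x) = ∏ (x − α_j)(x − q/α_j) … h(x) = ∏ (x − (α_j + q/α_j))» ∕ proof of Lemma 37 «a product of q-palindromic polynomials is also q-palindromic» (p0036–p0037)] -/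
theorem transform_mul (q : R) {n₁ n₂ : ℕ} {h₁ h₂ : R[X]} (hn₁ : h₁.natDegree ≤ n₁)
    (hn₂ : h₂.natDegree ≤ n₂) :
    (∑ j ∈ Finset.range (n₁ + n₂ + 1),
        C ((h₁ * h₂).coeff j) * X ^ (n₁ + n₂ - j) * (X ^ 2 + C q) ^ j) =
      (∑ j ∈ Finset.range (n₁ + 1), C (h₁.coeff j) * X ^ (n₁ - j) * (X ^ 2 + C q) ^ j) *
        ∑ j ∈ Finset.range (n₂ + 1), C (h₂.coeff j) * X ^ (n₂ - j) * (X ^ 2 + C q) ^ j := by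
  apply toLaurent_injective
  rw [map_mul, toLaurent_transform q _ _ (natDegree_mul_le.trans (Nat.add_le_add hn₁ hn₂)),
    toLaurent_transform q _ _ hn₁, toLaurent_transform q _ _ hn₂, map_mul, Nat.cast_add,
    LaurentPolynomial.T_add]
  ring

/-- **Linear factors**: `𝒯_{q,1}(X − β) = X² − βX + q` (the pair of roots `α, q/α` with
`α + q/α = β`). [cite: GoreskyTai2017RealStructuresOrdinary, App. §16.2 «β_i = α_i + q/α_i» ∕ proof of Prop. 36 (2) «the quadratic equation x² − β_i x + q = 0» (p0036–p0037)] -/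
theorem transform_X_sub_C (q β : R) :
    (∑ j ∈ Finset.range (1 + 1), C ((X - C β).coeff j) * X ^ (1 - j) * (X ^ 2 + C q) ^ j) =
      X ^ 2 - C β * X + C q := by
  simp [Finset.sum_range_succ, coeff_X, coeff_C]
  ring

/-- The transform of `1` (as a polynomial of degree `≤ n`) is `Xⁿ` (`xⁿ·h(x+q/x)` for `h = 1`). [cite: GoreskyTai2017RealStructuresOrdinary, App. §16.2 «p(x) = xⁿh(x + q/x)» (p0036)] -/
theorem transform_one (q : R) (n : ℕ) :
    (∑ j ∈ Finset.range (n + 1), C ((1 : R[X]).coeff j) * X ^ (n - j) * (X ^ 2 + C q) ^ j) =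
      X ^ n := by
  rw [← C_1, transform_C, C_1, one_mul]

/-- **Split real counterpart**: if `h = ∏_{β ∈ s} (X − β)` then
`𝒯_{q,|s|}(h) = ∏_{β ∈ s} (X² − βX + q)` — the printed `p(x) = ∏_j (x − α_j)(x − q/α_j)` for
`h(x) = ∏_j (x − (α_j + q/α_j))`. [cite: GoreskyTai2017RealStructuresOrdinary, App. §16.2 (the displayed factorisations of p and h) (p0036)] -/
theorem transform_multiset_prod_X_sub_C (q : R) (s : Multiset R) :
    (∑ j ∈ Finset.range (Multiset.card s + 1),
        C ((s.map fun β => X - C β).prod.coeff j) * X ^ (Multiset.card s - j) * (X ^ 2 + C q) ^ j) =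
      (s.map fun β => X ^ 2 - C β * X + C q).prod := by
  induction s using Multiset.induction_on with
  | empty => simp
  | cons β s ih =>
    have hdeg : (s.map fun β => X - C β).prod.natDegree ≤ Multiset.card s := by
      rcases subsingleton_or_nontrivial R with hR | hR
      · simp [natDegree_of_subsingleton]
      · exact (natDegree_multiset_prod_X_sub_C_eq_card s).le
    have hmul := transform_mul q (natDegree_X_sub_C_le β) hdeg
    rw [add_comm 1 (Multiset.card s)] at hmul
    rw [Multiset.map_cons, Multiset.prod_cons, Multiset.map_cons, Multiset.prod_cons,
      Multiset.card_cons, hmul, ih, transform_X_sub_C]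

/-! ## §6 Evaluation `p(x) = xⁿ h(x + q/x)` and roots -/

/-- **`p(x) = xⁿ · h(x + q·x⁻¹)`** at every unit `x`. [cite: GoreskyTai2017RealStructuresOrdinary, App. §16.1–§16.2 «p(x) = xⁿ h(x + q/x)» (p0036)] -/
theorem eval_transform (q : R) (n : ℕ) (h : R[X]) (hn : h.natDegree ≤ n) (x : Rˣ) :
    (∑ j ∈ Finset.range (n + 1), C (h.coeff j) * X ^ (n - j) * (X ^ 2 + C q) ^ j).eval (x : R) =
      (x : R) ^ n * h.eval ((x : R) + q * (x⁻¹ : Rˣ)) := by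
  conv_rhs => rw [h.as_sum_range' (n + 1) (Nat.lt_succ_of_le hn), eval_finsetSum, Finset.mul_sum]
  rw [eval_finsetSum]
  refine Finset.sum_congr rfl fun j hj => ?_
  have hj' : j ≤ n := Nat.lt_succ_iff.mp (Finset.mem_range.mp hj)
  simp only [eval_mul, eval_C, eval_pow, eval_X, eval_add, eval_monomial]
  have hx : ((x : R) ^ 2 + q) = (x : R) * ((x : R) + q * (x⁻¹ : Rˣ)) := by
    rw [mul_add, ← mul_assoc, mul_comm (x : R) q, mul_assoc, Units.mul_inv, mul_one, sq]
  rw [hx, mul_pow]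
  have hxn : (x : R) ^ n = (x : R) ^ (n - j) * (x : R) ^ j := by
    rw [← pow_add, Nat.sub_add_cancel hj']
  rw [hxn]; ring

section Field

variable {K : Type*} [Field K]

/-- Over a field: `p(x) = xⁿ · h(x + q/x)` for `x ≠ 0`.
[cite: GoreskyTai2017RealStructuresOrdinary, App. §16.2 «p(x) = xⁿ h(x + q/x)» (p0036)] -/
theorem eval_transform_of_ne_zero (q : K) (n : ℕ) (h : K[X]) (hn : h.natDegree ≤ n) {x : K}
    (hx : x ≠ 0) :
    (∑ j ∈ Finset.range (n + 1), C (h.coeff j) * X ^ (n - j) * (X ^ 2 + C q) ^ j).eval x =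
      x ^ n * h.eval (x + q / x) := by
  have h1 := eval_transform q n h hn (Units.mk0 x hx)
  simp only [Units.val_mk0, Units.val_inv_eq_inv_val] at h1
  rw [h1, div_eq_mul_inv]

/-- The constant coefficient of the transform of a monic `h` of degree `n` is `qⁿ` (`a₀ = qⁿ a_{2n}`, the case `r = n` of `q`-palindromicity). [cite: GoreskyTai2017RealStructuresOrdinary, App. §16.2 «a_{n−r} = q^r a_{n+r} for 1 ≤ r ≤ n» (p0036)] -/
theorem coeff_zero_transform_of_monic {R : Type*} [CommRing R] (q : R) (n : ℕ) {h : R[X]}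
    (hm : h.Monic) (hn : h.natDegree = n) :
    (∑ j ∈ Finset.range (n + 1), C (h.coeff j) * X ^ (n - j) * (X ^ 2 + C q) ^ j).coeff 0 =
      q ^ n := by
  have h1 := transform_pal q n h le_rfl
  rw [Nat.sub_self] at h1
  rw [h1]
  have h2 := coeff_transform_add_natDegree q n h
  rw [hn, if_pos le_rfl, hm.leadingCoeff] at h2
  rw [h2, mul_one]

/-- **Roots of `p` versus roots of `h`** (`q ≠ 0`, `h` monic of degree `n`): `p(α) = 0` iff `α ≠ 0` and
`h(α + q/α) = 0`. [cite: GoreskyTai2017RealStructuresOrdinary, App. §16.2 «β_i = α_i + q/α_i» (p0036)] -/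
theorem isRoot_transform_iff {q : K} (hq : q ≠ 0) (n : ℕ) {h : K[X]} (hm : h.Monic)
    (hn : h.natDegree = n) (x : K) :
    (∑ j ∈ Finset.range (n + 1), C (h.coeff j) * X ^ (n - j) * (X ^ 2 + C q) ^ j).IsRoot x ↔
      x ≠ 0 ∧ h.IsRoot (x + q / x) := by
  by_cases hx : x = 0
  · subst hx
    simp only [IsRoot.def, ne_eq, not_true_eq_false, false_and, iff_false, ← coeff_zero_eq_eval_zero,
      coeff_zero_transform_of_monic q n hm hn]
    exact pow_ne_zero n hq
  · rw [IsRoot.def, eval_transform_of_ne_zero q n h hn.le hx, mul_eq_zero, IsRoot.def]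
    simp [hx]

/-- **«for every root `π` of `p(x)` the number `qπ⁻¹` is also a root of `p(x)`»** (for `p = 𝒯_{q,n}(h)`,
`h` monic of degree `n`, `q ≠ 0`). [cite: GoreskyTai2017RealStructuresOrdinary, App. §16.2 «Thus p(x) is q-palindromic iff … for every root π of p(x) the number qπ⁻¹ is also a root» (p0036)] -/
theorem isRoot_transform_div {q : K} (hq : q ≠ 0) (n : ℕ) {h : K[X]} (hm : h.Monic)
    (hn : h.natDegree = n) {x : K}
    (hx : (∑ j ∈ Finset.range (n + 1), C (h.coeff j) * X ^ (n - j) * (X ^ 2 + C q) ^ j).IsRoot x) :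
    (∑ j ∈ Finset.range (n + 1), C (h.coeff j) * X ^ (n - j) * (X ^ 2 + C q) ^ j).IsRoot (q / x) := by
  rw [isRoot_transform_iff hq n hm hn] at hx ⊢
  obtain ⟨hx0, hr⟩ := hx
  refine ⟨div_ne_zero hq hx0, ?_⟩
  rwa [div_div_cancel₀ hq, add_comm]

/-- A root `β` of `h` and a root `α` of `x² − βx + q` give a root `α` of `p`.
[cite: GoreskyTai2017RealStructuresOrdinary, App. §16.2 proof of Prop. 36 (2) «α_i and q/α_i are the two roots of the quadratic equation x² − β_i x + q = 0» (p0037)] -/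
theorem isRoot_transform_of_quadratic {q : K} (hq : q ≠ 0) (n : ℕ) {h : K[X]} (hm : h.Monic)
    (hn : h.natDegree = n) {β α : K} (hβ : h.IsRoot β) (hα : α ^ 2 - β * α + q = 0) :
    (∑ j ∈ Finset.range (n + 1), C (h.coeff j) * X ^ (n - j) * (X ^ 2 + C q) ^ j).IsRoot α := by
  have hα0 : α ≠ 0 := by
    rintro rfl
    apply hq
    simpa using hα
  rw [isRoot_transform_iff hq n hm hn]
  refine ⟨hα0, ?_⟩
  have : α + q / α = β := by
    field_simp
    linear_combination hα
  rwa [this]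

end Field

end Literature.Algebra.Polynomial.QPalindromicRealCounterpart
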